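import Summits.Schanuel.Schanuel.Theorems.DiophantineDichotomyDefs
import Literature.NumberTheory.DiophantineApproximation.ApproximationByAlgebraicNumbersProofs

/-!
# Stub `stub_slotDichotomy_two : SlotDichotomyTwo` (crux `KhovanskiiApproxType`)

Line `lw-small-height` of crux stmt-Schanuel-6116; vocabulary: `Theorems/DiophantineDichotomyDefs`.
The `n = 2` slot dichotomy: a challenger `γ` with budget `(d, H)` either has both slots `γ (e i)`
of degree `≥ d^τ` over `ℚ` (`τ = p/(A+1)`) — then the primitive measure on the pair `θ ∘ e`
repels it — or a slot of degree `< d^τ` — then the floor at that slot, applied to an irreducible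
integer factor of the challenger's polynomial there (degree `= deg_ℚ γ(e i)`, height
`≤ 2^d (d+1) H` by the binomial / Mahler-measure bound), and the mean value estimate repel it;
the exponent is `a = A p/(A+1) < 1`.
-/

noncomputable section

set_option linter.dupNamespace false

open Polynomial

namespace Summit.Schanuel.Schanuel.Cruxes.KhovanskiiApproxType.LwSmallHeight

/-- The coefficients of the image of `f ∈ ℤ[X]` in `ℤ[X₀]` are those of `f`. -/
theorem coeff_toMvPolynomial_fin_one (f : ℤ[X]) (m : Fin 1 →₀ ℕ) :
    MvPolynomial.coeff m (f.toMvPolynomial (0 : Fin 1)) = f.coeff (m 0) := by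
  have hm : m = Finsupp.single 0 (m 0) := Finsupp.unique_single m
  induction f using Polynomial.induction_on' with
  | add p q hp hq => simp [hp, hq]
  | monomial n c =>
    rw [← C_mul_X_pow_eq_monomial, map_mul, map_pow, toMvPolynomial_C, toMvPolynomial_X,
      MvPolynomial.coeff_C_mul, MvPolynomial.coeff_X_pow, coeff_C_mul_X_pow]
    have hiff : Finsupp.single (0 : Fin 1) n = m ↔ n = m 0 := by
      conv_lhs => rw [hm]
      exact Finsupp.unique_single_eq_iff
    by_cases h : n = m 0
    · rw [if_pos (hiff.2 h), if_pos h.symm, mul_one]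
    · rw [if_neg (fun h' => h (hiff.1 h')), if_neg (Ne.symm h), mul_zero]

/-- The image of `f ∈ ℤ[X]` in `ℤ[X₀]`: total degree `≤ deg f`, height `≤` any coefficient bound. -/
theorem totalDegree_mvNatHeight_toMvPolynomial_le (f : ℤ[X]) (N : ℕ)
    (h : ∀ k, (f.coeff k).natAbs ≤ N) :
    (f.toMvPolynomial (0 : Fin 1)).totalDegree ≤ f.natDegree ∧
      mvNatHeight (f.toMvPolynomial (0 : Fin 1)) ≤ N := by
  refine ⟨Finset.sup_le fun m hm => ?_, Finset.sup_le fun m _ => ?_⟩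
  · have hc := MvPolynomial.mem_support_iff.1 hm
    rw [coeff_toMvPolynomial_fin_one] at hc
    have h2 : (m.sum fun _ e => e) = m 0 := by rw [Finsupp.sum_fintype _ _ (fun _ => rfl)]; simp
    rw [h2]
    exact le_natDegree_of_ne_zero hc
  · rw [coeff_toMvPolynomial_fin_one]
    exact h _

/-- A non-zero `P ∈ ℤ[X]` vanishing at `α ∈ ℂ` has an irreducible factor vanishing at `α`. -/
theorem exists_irreducible_factor_aeval_eq_zero (α : ℂ) (P : ℤ[X]) :
    P ≠ 0 → aeval α P = 0 → ∃ f : ℤ[X], Irreducible f ∧ f ∣ P ∧ aeval α f = 0 := by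
  induction P using WfDvdMonoid.induction_on_irreducible with
  | zero => intro h; exact absurd rfl h
  | unit u hu =>
    intro _ hα
    obtain ⟨r, hr, rfl⟩ := Polynomial.isUnit_iff.1 hu
    rw [aeval_C, algebraMap_int_eq, eq_intCast, Int.cast_eq_zero] at hα
    exact absurd hα hr.ne_zero
  | mul a i ha hi ih =>
    intro _ hα
    rw [map_mul, mul_eq_zero] at hα
    rcases hα with h | h
    · exact ⟨i, hi, dvd_mul_right i a, h⟩
    · obtain ⟨f, hf, hfa, hfα⟩ := ih ha h
      exact ⟨f, hf, hfa.trans (dvd_mul_left a i), hfα⟩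

/-- A non-zero `P ∈ ℤ[X]` with a complex root `α` has positive degree, and `α` is integral. -/
theorem natDegree_pos_of_aeval_eq_zero {α : ℂ} {P : ℤ[X]} (hP : P ≠ 0) (hα : aeval α P = 0) :
    0 < P.natDegree ∧ IsIntegral ℚ α := by
  refine ⟨Nat.pos_of_ne_zero fun h0 => ?_, ?_⟩
  · obtain ⟨c, hc⟩ : ∃ c, P = C c := ⟨_, eq_C_of_natDegree_eq_zero h0⟩
    have hc0 : c ≠ 0 := by rintro rfl; exact hP (by rw [hc, map_zero])
    rw [hc, aeval_C, algebraMap_int_eq, eq_intCast, Int.cast_eq_zero] at hα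
    exact hc0 hα
  · refine (show IsAlgebraic ℚ α from ⟨P.map (Int.castRingHom ℚ), ?_, ?_⟩).isIntegral
    · exact (Polynomial.map_ne_zero_iff (Int.castRingHom ℚ).injective_int).mpr hP
    · rw [← algebraMap_int_eq, aeval_map_algebraMap]; exact hα

/-- An irreducible `f ∈ ℤ[X]` vanishing at `α ∈ ℂ` has `deg f = deg_ℚ α` (Gauss's lemma). -/
theorem natDegree_eq_of_irreducible_of_aeval_eq_zero {f : ℤ[X]} (hf : Irreducible f) {α : ℂ}
    (hα : aeval α f = 0) : f.natDegree = (minpoly ℚ α).natDegree := by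
  have hirrQ : Irreducible (f.map (Int.castRingHom ℚ)) :=
    (IsPrimitive.Int.irreducible_iff_irreducible_map_cast
      (hf.isPrimitive (natDegree_pos_of_aeval_eq_zero hf.ne_zero hα).1.ne')).1 hf
  have hαQ : aeval α (f.map (Int.castRingHom ℚ)) = 0 := by
    rw [← algebraMap_int_eq, aeval_map_algebraMap]; exact hα
  rw [← minpoly.eq_of_irreducible hirrQ hαQ,
    natDegree_mul_C (inv_ne_zero (leadingCoeff_ne_zero.2 hirrQ.ne_zero)),
    natDegree_map_eq_of_injective (Int.castRingHom ℚ).injective_int]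

/-- Mignotte-type bound: a factor `f` of a non-zero `P ∈ ℤ[X]` (`deg P ≤ d`, height `≤ H`) has
`|f_k| ≤ (deg f choose k) M(f) ≤ 2^d M(P) ≤ 2^d √(deg P + 1) H ≤ 2^d (d+1) H`. -/
theorem abs_coeff_le_of_dvd {f P : ℤ[X]} {d H : ℕ} (hfP : f ∣ P) (hP : P ≠ 0)
    (hdeg : P.natDegree ≤ d) (hH : ∀ k, |P.coeff k| ≤ (H : ℤ)) (k : ℕ) :
    |(f.coeff k : ℝ)| ≤ 2 ^ d * ((d : ℝ) + 1) * H := by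
  have h1 := norm_coeff_le_choose_mul_mahlerMeasure k (f.map (Int.castRingHom ℂ))
  rw [coeff_map, eq_intCast, Complex.norm_intCast,
    natDegree_map_eq_of_injective Int.cast_injective] at h1
  have hchoose : (f.natDegree.choose k : ℝ) ≤ 2 ^ d := by
    calc (f.natDegree.choose k : ℝ) ≤ ((2 ^ f.natDegree : ℕ) : ℝ) := by
          exact_mod_cast Nat.choose_le_two_pow _ _
      _ = 2 ^ f.natDegree := by push_cast; ring
      _ ≤ 2 ^ d := pow_le_pow_right₀ (by norm_num) ((natDegree_le_of_dvd hfP hP).trans hdeg)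
  have hM : (f.map (Int.castRingHom ℂ)).mahlerMeasure ≤ ((d : ℝ) + 1) * H := by
    refine (Literature.NumberTheory.DiophantineApproximation.mahlerMeasure_map_le_of_dvd
      hfP hP).trans ?_
    set p₀ := P.map (Int.castRingHom ℂ) with hp₀
    have hsup : p₀.supNorm ≤ H := by
      obtain ⟨i, hi⟩ := p₀.exists_eq_supNorm
      rw [hi, hp₀, coeff_map, eq_intCast, Complex.norm_intCast]
      exact_mod_cast hH i
    have hdegp₀ : (p₀.natDegree : ℝ) ≤ d := by exact_mod_cast (natDegree_map_le).trans hdeg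
    have hsq : Real.sqrt (p₀.natDegree + 1) ≤ (d : ℝ) + 1 := by
      rw [Real.sqrt_le_left (by positivity)]
      nlinarith
    calc p₀.mahlerMeasure ≤ Real.sqrt (p₀.natDegree + 1) * p₀.supNorm :=
          mahlerMeasure_le_sqrt_natDegree_add_one_mul_supNorm p₀
      _ ≤ ((d : ℝ) + 1) * H := by have := p₀.supNorm_nonneg; gcongr
  calc |(f.coeff k : ℝ)| ≤ (f.natDegree.choose k : ℝ) * (f.map (Int.castRingHom ℂ)).mahlerMeasure :=
        h1
    _ ≤ 2 ^ d * (((d : ℝ) + 1) * H) := by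
        have := mahlerMeasure_nonneg (f.map (Int.castRingHom ℂ))
        gcongr
    _ = 2 ^ d * ((d : ℝ) + 1) * H := by ring

/-- `‖x^k − y^k‖ ≤ k R^k ‖x − y‖` for `‖x‖, ‖y‖ ≤ R`, `1 ≤ R`. -/
theorem norm_pow_sub_pow_le {x y : ℂ} {R : ℝ} (hR : 1 ≤ R) (hx : ‖x‖ ≤ R) (hy : ‖y‖ ≤ R) :
    ∀ k : ℕ, ‖x ^ k - y ^ k‖ ≤ k * R ^ k * ‖x - y‖
  | 0 => by simp
  | k + 1 => by
    have ih := norm_pow_sub_pow_le hR hx hy k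
    have hR0 : 0 ≤ R := zero_le_one.trans hR
    have hpow : R ^ k * ‖x - y‖ ≤ R ^ (k + 1) * ‖x - y‖ :=
      mul_le_mul_of_nonneg_right (pow_le_pow_right₀ hR k.le_succ) (norm_nonneg (x - y))
    rw [show x ^ (k + 1) - y ^ (k + 1) = x * (x ^ k - y ^ k) + (x - y) * y ^ k by ring]
    calc ‖x * (x ^ k - y ^ k) + (x - y) * y ^ k‖
        ≤ ‖x * (x ^ k - y ^ k)‖ + ‖(x - y) * y ^ k‖ := norm_add_le _ _
      _ = ‖x‖ * ‖x ^ k - y ^ k‖ + ‖x - y‖ * ‖y‖ ^ k := by rw [norm_mul, norm_mul, norm_pow]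
      _ ≤ R * (k * R ^ k * ‖x - y‖) + ‖x - y‖ * R ^ k := by gcongr
      _ ≤ ((k + 1 : ℕ) : ℝ) * R ^ (k + 1) * ‖x - y‖ := by
          rw [pow_succ] at hpow ⊢; push_cast; nlinarith

/-- Mean value estimate for an integer polynomial with coefficients bounded by `B`, degree `≤ n`,
on the disc of radius `R ≥ 1`: `‖f(x) − f(y)‖ ≤ (n+1) B n Rⁿ ‖x − y‖`. -/
theorem norm_aeval_sub_aeval_le (f : ℤ[X]) {x y : ℂ} {R B : ℝ} {n : ℕ} (hR : 1 ≤ R)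
    (hx : ‖x‖ ≤ R) (hy : ‖y‖ ≤ R) (hB : ∀ k, |(f.coeff k : ℝ)| ≤ B) (hn : f.natDegree ≤ n) :
    ‖aeval x f - aeval y f‖ ≤ ((n : ℝ) + 1) * (B * (n * R ^ n)) * ‖x - y‖ := by
  have hlt : f.natDegree < n + 1 := Nat.lt_succ_of_le hn
  rw [aeval_eq_sum_range' hlt, aeval_eq_sum_range' hlt, ← Finset.sum_sub_distrib]
  have hR0 : 0 ≤ R := zero_le_one.trans hR
  have hB0 : 0 ≤ B := (abs_nonneg _).trans (hB 0)
  calc ‖∑ i ∈ Finset.range (n + 1), (f.coeff i • x ^ i - f.coeff i • y ^ i)‖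
      ≤ ∑ i ∈ Finset.range (n + 1), ‖f.coeff i • x ^ i - f.coeff i • y ^ i‖ := norm_sum_le _ _
    _ ≤ ∑ i ∈ Finset.range (n + 1), B * (n * R ^ n) * ‖x - y‖ := by
        refine Finset.sum_le_sum fun i hi => ?_
        have hin : i ≤ n := Nat.lt_succ_iff.1 (Finset.mem_range.1 hi)
        rw [← smul_sub, zsmul_eq_mul, norm_mul, Complex.norm_intCast]
        have h2 : (i : ℝ) * R ^ i ≤ n * R ^ n := by
          have : R ^ i ≤ R ^ n := pow_le_pow_right₀ hR hin
          have hin' : (i : ℝ) ≤ n := by exact_mod_cast hin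
          have : (0 : ℝ) ≤ R ^ i := pow_nonneg hR0 i
          gcongr
        calc |(f.coeff i : ℝ)| * ‖x ^ i - y ^ i‖ ≤ B * (i * R ^ i * ‖x - y‖) := by
              gcongr
              exacts [hB i, norm_pow_sub_pow_le hR hx hy i]
          _ ≤ B * (n * R ^ n * ‖x - y‖) := by gcongr
          _ = B * (n * R ^ n) * ‖x - y‖ := by ring
    _ = ((n : ℝ) + 1) * (B * (n * R ^ n)) * ‖x - y‖ := by
        rw [Finset.sum_const, Finset.card_range, nsmul_eq_mul]; push_cast; ring

/-- Case-1 bookkeeping: `C(d^p (L + d)/d' + d^q) ≤ C'(dᵃ L + dᵇ)` for `d' ≥ d^τ`, `p − τ = a`,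
`b ≥ a + 1`, `b ≥ q`, `C' ≥ 2C`. -/
theorem bookkeeping_one {C C' p q a b τ d d' L : ℝ} (hC : 0 < C) (hCC' : 2 * C ≤ C')
    (hd : 1 ≤ d) (hL : 0 ≤ L) (hτd' : d ^ τ ≤ d') (hpa : p - τ = a)
    (hb1 : a + 1 ≤ b) (hbq : q ≤ b) :
    C * (d ^ p * (L + d) / d' + d ^ q) ≤ C' * (d ^ a * L + d ^ b) := by
  have hd0 : 0 < d := one_pos.trans_le hd
  have hdτ : 0 < d ^ τ := Real.rpow_pos_of_pos hd0 τ
  have hda0 : 0 ≤ d ^ a := (Real.rpow_pos_of_pos hd0 a).le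
  have hdb0 : 0 ≤ d ^ b := (Real.rpow_pos_of_pos hd0 b).le
  have h1 : d ^ p * (L + d) / d' ≤ d ^ a * (L + d) := by
    rw [show d ^ p = d ^ a * d ^ τ by rw [← Real.rpow_add hd0, ← hpa, sub_add_cancel],
      div_le_iff₀ (hdτ.trans_le hτd')]
    calc d ^ a * d ^ τ * (L + d) = d ^ a * (L + d) * d ^ τ := by ring
      _ ≤ d ^ a * (L + d) * d' := mul_le_mul_of_nonneg_left hτd' (mul_nonneg hda0 (by linarith))
  have h2 : d ^ a * d ≤ d ^ b := by
    rw [← Real.rpow_add_one hd0.ne' a]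
    exact Real.rpow_le_rpow_of_exponent_le hd hb1
  have h3 : d ^ q ≤ d ^ b := Real.rpow_le_rpow_of_exponent_le hd hbq
  nlinarith [mul_le_mul_of_nonneg_left h1 hC.le, mul_le_mul_of_nonneg_left h2 hC.le,
    mul_le_mul_of_nonneg_left h3 hC.le, mul_le_mul_of_nonneg_right hCC' hdb0,
    mul_le_mul_of_nonneg_right (show C ≤ C' by linarith) (mul_nonneg hda0 hL)]

/-- Case-2 bookkeeping: the slot floor's exponent plus the mean-value losses is at most
`C'(dᵃ L + dᵇ)` for `τ A = a`, `b ≥ a + 1`, `b ≥ τ K⁺`, `C' ≥ 3 C₁ + 4 + log R`. -/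
theorem bookkeeping_two {C₁ C' A Kp a b τ d L lR : ℝ} (hC₁ : 0 < C₁)
    (hC' : 3 * C₁ + 4 + lR ≤ C') (hlR : 0 ≤ lR) (hd : 1 ≤ d) (hL : 0 ≤ L)
    (hτA : τ * A = a) (ha : 0 ≤ a) (hb1 : a + 1 ≤ b) (hbK : τ * Kp ≤ b) :
    C₁ * ((d ^ τ) ^ A * (2 * d + L) + (d ^ τ) ^ Kp) + ((4 + lR) * d + L) ≤
      C' * (d ^ a * L + d ^ b) := by
  have hd0 : 0 < d := one_pos.trans_le hd
  have hda0 : 0 ≤ d ^ a := (Real.rpow_pos_of_pos hd0 a).le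
  have hdb0 : 0 ≤ d ^ b := (Real.rpow_pos_of_pos hd0 b).le
  have h2 : (d ^ τ) ^ Kp ≤ d ^ b := by
    rw [← Real.rpow_mul hd0.le]
    exact Real.rpow_le_rpow_of_exponent_le hd hbK
  have h3 : d ≤ d ^ b := by
    calc d = d ^ (1 : ℝ) := (Real.rpow_one d).symm
      _ ≤ d ^ b := Real.rpow_le_rpow_of_exponent_le hd (by linarith)
  have h4 : d ^ a * d ≤ d ^ b := by
    rw [← Real.rpow_add_one hd0.ne' a]
    exact Real.rpow_le_rpow_of_exponent_le hd hb1
  rw [show (d ^ τ) ^ A = d ^ a by rw [← Real.rpow_mul hd0.le, hτA]]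
  nlinarith [mul_le_mul_of_nonneg_left h4 hC₁.le, mul_le_mul_of_nonneg_left h2 hC₁.le,
    mul_le_mul_of_nonneg_left h3 (show (0 : ℝ) ≤ 4 + lR by linarith),
    le_mul_of_one_le_left hL (Real.one_le_rpow hd ha),
    mul_le_mul_of_nonneg_right (show C₁ + 1 ≤ C' by linarith) (mul_nonneg hda0 hL),
    mul_le_mul_of_nonneg_right hC' hdb0]

/-- Small-slot repulsion: if the root `α` of `P ≠ 0` (`deg P ≤ d`, height `≤ H`) has degree `≤ d^τ`
over `ℚ`, the floor `(A, K, C₁)` at `ξ` applied to an irreducible factor `f` of `P` with `f(α) = 0`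
and `|f(ξ)| = |f(ξ) − f(α)| ≤ (d+1) H(f) d R^d |ξ − α|` (`‖ξ‖, ‖α‖ ≤ R`) give
`exp(−C₁((d^τ)^A (2d + log H) + (d^τ)^{K⁺})) ≤ exp((4 + log R) d + log H) · |α − ξ|`. -/
theorem slot_repulsion {ξ α : ℂ} {A K C₁ Kp τ R : ℝ} {P : ℤ[X]} {d H : ℕ}
    (hfloor : SlotFloor ξ A K C₁) (hA : 0 < A) (hK : K ≤ Kp) (hKp : 0 ≤ Kp)
    (hP0 : P ≠ 0) (hPdeg : P.natDegree ≤ d) (hPH : ∀ k, |P.coeff k| ≤ (H : ℤ))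
    (hPα : aeval α P = 0) (hdeg : ((minpoly ℚ α).natDegree : ℝ) ≤ (d : ℝ) ^ τ)
    (hd1 : (1 : ℝ) ≤ d) (hH1 : (1 : ℝ) ≤ H) (hR : 1 ≤ R) (hξR : ‖ξ‖ ≤ R) (hαR : ‖α‖ ≤ R) :
    Real.exp (-(C₁ * (((d : ℝ) ^ τ) ^ A * (2 * d + Real.log H) + ((d : ℝ) ^ τ) ^ Kp))) ≤
      Real.exp ((4 + Real.log R) * d + Real.log H) * ‖α - ξ‖ := by
  have hd0 : (0 : ℝ) < d := one_pos.trans_le hd1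
  have hH0 : (0 : ℝ) < H := one_pos.trans_le hH1
  have hdτ0 : 0 < (d : ℝ) ^ τ := Real.rpow_pos_of_pos hd0 τ
  obtain ⟨f, hfirr, hfP, hfα⟩ := exists_irreducible_factor_aeval_eq_zero α P hP0 hPα
  have hf0 : f ≠ 0 := hfirr.ne_zero
  have hfd : f.natDegree ≤ d := (natDegree_le_of_dvd hfP hP0).trans hPdeg
  have hfτ : (f.natDegree : ℝ) ≤ (d : ℝ) ^ τ := by
    rw [natDegree_eq_of_irreducible_of_aeval_eq_zero hfirr hfα]; exact hdeg
  have hf1 : (1 : ℝ) ≤ f.natDegree := by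
    exact_mod_cast (natDegree_pos_of_aeval_eq_zero hf0 hfα).1
  set Bh : ℝ := 2 ^ d * ((d : ℝ) + 1) * H with hBh
  have hcoeff : ∀ k, |(f.coeff k : ℝ)| ≤ Bh := abs_coeff_le_of_dvd hfP hP0 hPdeg hPH
  have j1 : (d : ℝ) + 1 ≤ Real.exp d := Real.add_one_le_exp d
  have j2 : (2 : ℝ) ^ d ≤ Real.exp d := by
    calc (2 : ℝ) ^ d ≤ (Real.exp 1) ^ d :=
          pow_le_pow_left₀ (by norm_num) (by linarith [Real.add_one_le_exp (1 : ℝ)]) d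
      _ = Real.exp d := by rw [← Real.exp_nat_mul, mul_one]
  have hBh1 : 1 ≤ Bh :=
    one_le_mul_of_one_le_of_one_le (one_le_mul_of_one_le_of_one_le (one_le_pow₀ (by norm_num))
      (by linarith)) hH1
  have hBh0 : 0 < Bh := one_pos.trans_le hBh1
  have hlogBh : Real.log Bh ≤ 2 * d + Real.log H := by
    have h : Bh ≤ Real.exp d * Real.exp d * H := by rw [hBh]; gcongr
    have h' := Real.log_le_log hBh0 h
    rw [Real.log_mul (mul_pos (Real.exp_pos _) (Real.exp_pos _)).ne' hH0.ne',
      Real.log_mul (Real.exp_pos _).ne' (Real.exp_pos _).ne', Real.log_exp] at h'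
    linarith
  have hkey := hfloor.2 (f.toMvPolynomial (0 : Fin 1))
    (fun h => hf0 (Polynomial.toMvPolynomial_injective (0 : Fin 1) (by rw [h, map_zero])))
  rw [MvPolynomial.aeval_toMvPolynomial] at hkey
  set X₁ : ℝ := max 1 ((f.toMvPolynomial (0 : Fin 1)).totalDegree : ℝ) with hX₁
  set Y₁ : ℝ := max 1 (mvNatHeight (f.toMvPolynomial (0 : Fin 1)) : ℝ) with hY₁
  have hnat : ∀ k, (f.coeff k).natAbs ≤ ⌊Bh⌋₊ := fun k => by
    rw [Nat.le_floor_iff hBh0.le, ← Int.cast_natCast, Int.natCast_natAbs, Int.cast_abs]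
    exact hcoeff k
  obtain ⟨hFdeg, hFht⟩ := totalDegree_mvNatHeight_toMvPolynomial_le f ⌊Bh⌋₊ hnat
  have hX1 : 1 ≤ X₁ := le_max_left _ _
  have hX0 : 0 ≤ X₁ := zero_le_one.trans hX1
  have hXτ : X₁ ≤ (d : ℝ) ^ τ :=
    max_le (hf1.trans hfτ) (le_trans (by exact_mod_cast hFdeg) hfτ)
  have hY1 : 1 ≤ Y₁ := le_max_left _ _
  have hYB : Y₁ ≤ Bh :=
    max_le hBh1 ((show (mvNatHeight (f.toMvPolynomial (0 : Fin 1)) : ℝ) ≤ (⌊Bh⌋₊ : ℝ) by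
      exact_mod_cast hFht).trans (Nat.floor_le hBh0.le))
  have hE1 : Real.exp (-(C₁ * (((d : ℝ) ^ τ) ^ A * (2 * d + Real.log H) + ((d : ℝ) ^ τ) ^ Kp)))
      ≤ ‖aeval ξ f‖ := by
    refine le_trans (Real.exp_le_exp.2 (neg_le_neg (mul_le_mul_of_nonneg_left (add_le_add
      (mul_le_mul (Real.rpow_le_rpow hX0 hXτ hA.le)
        ((Real.log_le_log (one_pos.trans_le hY1) hYB).trans hlogBh) (Real.log_nonneg hY1)
        (Real.rpow_pos_of_pos hdτ0 A).le)
      ((Real.rpow_le_rpow_of_exponent_le hX1 hK).trans (Real.rpow_le_rpow hX0 hXτ hKp)))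
      hfloor.1.le))) hkey
  have hmv : ‖aeval ξ f‖ ≤ ((d : ℝ) + 1) * (Bh * (d * R ^ d)) * ‖ξ - α‖ := by
    simpa only [hfα, sub_zero] using norm_aeval_sub_aeval_le f hR hξR hαR hcoeff hfd
  have hD : ((d : ℝ) + 1) * (Bh * (d * R ^ d)) ≤ Real.exp ((4 + Real.log R) * d + Real.log H) := by
    have e1 : Real.exp d * Real.exp d * Real.exp d * Real.exp d * R ^ d * H =
        Real.exp ((4 + Real.log R) * d + Real.log H) := by
      rw [show (4 + Real.log R) * d + Real.log H =
          (d : ℝ) + d + d + d + Real.log R * d + Real.log H by ring]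
      simp only [Real.exp_add]
      rw [Real.exp_log hH0, ← Real.rpow_def_of_pos (one_pos.trans_le hR), Real.rpow_natCast]
    have j3 : (d : ℝ) ≤ Real.exp d := by linarith
    rw [← e1, hBh]
    calc ((d : ℝ) + 1) * (2 ^ d * ((d : ℝ) + 1) * H * (d * R ^ d))
        = ((d : ℝ) + 1) * 2 ^ d * ((d : ℝ) + 1) * d * R ^ d * H := by ring
      _ ≤ Real.exp d * Real.exp d * Real.exp d * Real.exp d * R ^ d * H := by gcongr
  rw [norm_sub_rev]
  exact hE1.trans (hmv.trans (mul_le_mul_of_nonneg_right hD (norm_nonneg _)))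

/-- **Stub `stub_slotDichotomy_two`**: at `θ = (s, e^s) ∈ ℂ⁴`, a primitive approximation measure
`(p, q, C)` at the pair `θ ∘ e` plus slot floors with degree exponent `A` at both `θ (e i)` give
approximation type `(a, b, C')`, `a = A p/(A+1) < 1`, `b = a + |q| + τ K⁺ + 3` (`τ = p/(A+1)`,
`K⁺ = max K₀ K₁ 0`), `C' = 3(C + C₀ + C₁) + 5 + log(‖θ‖ + 2)`, by the slot dichotomy at `d^τ`. -/
theorem stub_slotDichotomy_two : SlotDichotomyTwo := by
  intro s e p q C A _ hp hA hrace hPM hfl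
  choose Kf Cf hKC using hfl
  set θ : Fin 2 ⊕ Fin 2 → ℂ := Sum.elim s (Complex.exp ∘ s) with hθ
  set τ : ℝ := p / (A + 1) with hτ
  set a : ℝ := A * p / (A + 1) with ha
  set Kp : ℝ := max (max (Kf 0) (Kf 1)) 0 with hKp
  set b : ℝ := a + |q| + τ * Kp + 3 with hb
  set R : ℝ := ‖θ‖ + 2 with hR
  set C' : ℝ := 3 * (C + Cf 0 + Cf 1) + 5 + Real.log R with hC'
  have hA1 : 0 < A + 1 := by linarith
  have hτ0 : 0 ≤ τ := div_nonneg hp hA1.le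
  have ha0 : 0 ≤ a := div_nonneg (mul_nonneg hA.le hp) hA1.le
  have ha1 : a < 1 := by rw [ha, div_lt_one hA1]; exact hrace
  have hpa : p - τ = a := by rw [hτ, ha]; field_simp; ring
  have hτA : τ * A = a := by rw [hτ, ha]; ring
  have hKp0 : 0 ≤ Kp := le_max_right _ _
  have hτK : 0 ≤ τ * Kp := mul_nonneg hτ0 hKp0
  have hb1 : a + 1 ≤ b := by rw [hb]; linarith [abs_nonneg q]
  have hbq : q ≤ b := by rw [hb]; linarith [le_abs_self q]
  have hbK : τ * Kp ≤ b := by rw [hb]; linarith [abs_nonneg q]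
  have hC0 : 0 < C := hPM.1
  have hCf0 : 0 < Cf 0 := (hKC 0).1
  have hCf1 : 0 < Cf 1 := (hKC 1).1
  have hR1 : 1 ≤ R := by have := norm_nonneg θ; rw [hR]; linarith
  have hlogR : 0 ≤ Real.log R := Real.log_nonneg hR1
  have hC'pos : 0 < C' := by rw [hC']; linarith
  have hCC' : 2 * C ≤ C' := by rw [hC']; linarith
  have hKall : ∀ i : Fin 2, Kf i ≤ Kp := Fin.forall_fin_two.2
    ⟨(le_max_left _ _).trans (le_max_left _ _), (le_max_right _ _).trans (le_max_left _ _)⟩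
  have hCall : ∀ i : Fin 2, 3 * Cf i + 4 + Real.log R ≤ C' := Fin.forall_fin_two.2
    ⟨by rw [hC']; linarith, by rw [hC']; linarith⟩
  refine ⟨a, b, C', ha1, hC'pos, ?_⟩
  intro d H γ hfr hpoly
  obtain ⟨P₀, hP₀0, hP₀deg, hP₀H, hP₀γ⟩ := hpoly (e 0)
  have hd1 : 1 ≤ d := (natDegree_pos_of_aeval_eq_zero hP₀0 hP₀γ).1.trans_le hP₀deg
  have hH1 : (1 : ℤ) ≤ H :=
    (Int.one_le_abs (leadingCoeff_ne_zero.2 hP₀0)).trans (hP₀H P₀.natDegree)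
  have hint : ∀ j, IsIntegral ℚ (γ j) := fun j => by
    obtain ⟨P, hP0, -, -, hPγ⟩ := hpoly j
    exact (natDegree_pos_of_aeval_eq_zero hP0 hPγ).2
  have hd1r : (1 : ℝ) ≤ d := by exact_mod_cast hd1
  have hH1r : (1 : ℝ) ≤ H := by exact_mod_cast hH1
  have hd0 : (0 : ℝ) < d := one_pos.trans_le hd1r
  have hlogH : 0 ≤ Real.log H := Real.log_nonneg hH1r
  have hX0 : 0 ≤ C' * ((d : ℝ) ^ a * Real.log H + (d : ℝ) ^ b) :=
    mul_nonneg hC'pos.le (by linarith [mul_nonneg (Real.rpow_pos_of_pos hd0 a).le hlogH,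
      (Real.rpow_pos_of_pos hd0 b).le])
  by_cases hfar : 1 < ‖γ - θ‖
  · exact le_trans (by rw [Real.exp_le_one_iff]; linarith) hfar.le
  push Not at hfar
  have hcoord : ∀ j, ‖γ j - θ j‖ ≤ ‖γ - θ‖ := fun j => by simpa using norm_le_pi_norm (γ - θ) j
  have hθj : ∀ j, ‖θ j‖ ≤ ‖θ‖ := fun j => norm_le_pi_norm θ j
  by_cases hsmall : ∃ i : Fin 2, ((minpoly ℚ (γ (e i))).natDegree : ℝ) < (d : ℝ) ^ τ
  · obtain ⟨i, hi⟩ := hsmall -- CASE 2: a slot of small degree — floor at that slot + mean value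
    obtain ⟨P, hP0, hPdeg, hPH, hPγ⟩ := hpoly (e i)
    have hξR : ‖θ (e i)‖ ≤ R := by have := hθj (e i); rw [hR]; linarith
    have hαR : ‖γ (e i)‖ ≤ R := by
      linarith [hcoord (e i), hθj (e i), norm_sub_norm_le (γ (e i)) (θ (e i))]
    have hrep := slot_repulsion (hKC i) hA (hKall i) hKp0 hP0 hPdeg hPH hPγ hi.le hd1r hH1r hR1
      hξR hαR
    have hbk := bookkeeping_two (hKC i).1 (hCall i) hlogR hd1r hlogH hτA ha0 hb1 hbK
      (A := A) (Kp := Kp) (d := (d : ℝ))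
    have hmul : Real.exp ((4 + Real.log R) * d + Real.log H) *
        Real.exp (-(C' * ((d : ℝ) ^ a * Real.log H + (d : ℝ) ^ b))) ≤
        Real.exp ((4 + Real.log R) * d + Real.log H) * ‖γ (e i) - θ (e i)‖ := by
      rw [← Real.exp_add]
      exact le_trans (Real.exp_le_exp.2 (by linarith)) hrep
    exact (le_of_mul_le_mul_left hmul (Real.exp_pos _)).trans (hcoord (e i))
  · push Not at hsmall -- CASE 1: both slots of degree `≥ d^τ` — the primitive measure on the pair
    have hfr' : Module.finrank ℚ ↥(IntermediateField.adjoin ℚ (Set.range (γ ∘ e))) ≤ d := by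
      refine le_trans ?_ hfr
      haveI : FiniteDimensional ℚ ↥(IntermediateField.adjoin ℚ (Set.range γ)) :=
        IntermediateField.finiteDimensional_adjoin (fun x hx => by
          obtain ⟨j, rfl⟩ := hx
          exact hint j)
      exact IntermediateField.finrank_le_of_le_right
        (IntermediateField.adjoin.mono ℚ _ _ (Set.range_comp_subset_range e γ))
    have hkey := hPM.2 d ⌈(d : ℝ) ^ τ⌉₊ H (γ ∘ e)
      (Nat.one_le_ceil_iff.2 (Real.rpow_pos_of_pos hd0 _)) hfr' (fun i => Nat.ceil_le.2 (hsmall i))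
      (fun i => hpoly (e i))
    have hbk := bookkeeping_one hC0 hCC' hd1r hlogH (Nat.le_ceil ((d : ℝ) ^ τ)) hpa hb1 hbq
      (q := q)
    have hsup : ‖γ ∘ e - θ ∘ e‖ ≤ ‖γ - θ‖ :=
      (pi_norm_le_iff_of_nonneg (norm_nonneg _)).2 fun i => by
        simpa using norm_le_pi_norm (γ - θ) (e i)
    exact le_trans (Real.exp_le_exp.2 (by linarith)) (hkey.trans hsup)

end Summit.Schanuel.Schanuel.Cruxes.KhovanskiiApproxType.LwSmallHeight

end
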